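import Summits.CriticalPhenomena.PercolationContinuityZ3.Theorems.PercNearOneGluingNoHeavyLowerTailSahiHittingSlotPrelim

/-!
# `NoHeavyLowerTail` (crux stmt-CriticalPhenomena-4575), Sahi / Kahn positivity with ONE HITTING SLOT — the certificate weights

Support file (cell `prim-l12`, seat P3, gen 3; `--supports stmt-CriticalPhenomena-4575`).  No `sorry`, no named facts, standard axioms.
Continues `…SahiHittingSlotPrelim`; prepares the two-configuration lemma and the main theorem of `…SahiHittingSlot`
(`E₃(1_{H_A},1_U,1_V) ≥ 0` for every hitting event `H_A` and all increasing `U, V`).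

* FIRST-OPEN WEIGHTS (a linear order on `ι` is fixed): `sig A p a = dlt·p_a·Π_{b∈A, b<a}(1 − p_b)` = `dlt` × P(`a` is the smallest open
  coordinate of `A`); `Σ_{a∈A} sig = dlt(1 − dlt)` (`sum_sig`), `Σ_{a∈I} sig ≤ dlt(1 − Π_{a∈I}(1 − p_a))` for `I ⊆ A` (`sum_sig_le`);
* the singleton bookkeeping `sOne X = Σ_a sig_a 1_X({a})`, `sTwo X Z = Σ_a sig_a 1_X({a})1_Z({a})`, with `sOne X ≤ dlt·μ(X)` (`sOne_le`) and
  `sTwo X Z ≤ (1+dlt)·Cov(X,Z)` for `A`-determined increasing `X, Z ∌ ∅` (`sTwo_le_cov`, from the covariance lemma);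
* THE CERTIFICATE WEIGHT `Wt ζ` on configurations: `0` if `A` is closed in `ζ`, `(1 + dlt) − (1−p_a)Π_{b<a}(1−p_b)` if exactly `a ∈ A` is
  open, `1 + dlt` otherwise; `Wt ≥ 0` (`Wt_nonneg`) and the expectation formula (`ex_Wt_mul`)
  `E[Wt·1_X·1_Z] = (1+dlt)(μ(X∩Z) − dlt·1_X(∅)1_Z(∅)) − sTwo X Z` for `A`-determined `X, Z`;
* the two-copy kernel `gfun` and its localised form `gfun_loc`;
* LOCALISED EVENTS `loc A ω X = {ζ | (ζ ∩ A) ∪ (ω ∖ A) ∈ X}` (sections over the outside configuration read as `A`-determined events of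
  the whole cube) and the block-Fubini resampling identity `μ(X) = Σ_ω w(ω) μ(loc_ω X)` (`pr_eq_sum_loc`, from `BHK2006.blockFubini`).
-/

noncomputable section

open scoped Classical

namespace Summit.CriticalPhenomena.PercolationContinuityZ3.Theorems

namespace SahiHittingSlot

open Finset
open Literature.Combinatorics.Sahi2008
open Literature.Probability.Percolation (DeterminedBy determinedBy_iff)
open SahiCombTensor (sum_bernoulliWeight_inter_eq)
open Literature.Probability.Percolation.BHK2006 (weight weight_nonneg harris harris_anti_anti blockFubini ind_inter ind_mono ind_le_one)
open Literature.Probability.Percolation.DecisionTree (ind ind_of_mem ind_of_not_mem ind_nonneg)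

variable {ι : Type} [Fintype ι]

/-! ### First-open weights (a linear order on the coordinates is fixed) -/

section Ordered

variable [LinearOrder ι]

/-- The FIRST-OPEN weight of `a`: `sig A p a = dlt A p · p_a · Π_{b ∈ A, b < a}(1 − p_b)` (`dlt` times the probability that `a` is
the smallest open coordinate of `A`). [this work] -/
def sig (A : Finset ι) (p : ι → unitInterval) (a : ι) : ℝ :=
  dlt A p * ((p a : ℝ) * ∏ b ∈ A with b < a, (1 - (p b : ℝ)))

omit [Fintype ι] in
/-- `sig ≥ 0`. [this work] -/
theorem sig_nonneg (A : Finset ι) (p : ι → unitInterval) (a : ι) : 0 ≤ sig A p a :=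
  mul_nonneg (dlt_nonneg A p) (mul_nonneg (p_nonneg p a) (prod_nonneg fun b _ => sub_nonneg.2 (p_le_one p b)))

omit [Fintype ι] in
/-- Telescoping: `Σ_{a∈I} p_a Π_{b∈I, b<a}(1 − p_b) = 1 − Π_{a∈I}(1 − p_a)`. [folklore] -/
theorem sum_firstOpen_eq (I : Finset ι) (p : ι → unitInterval) :
    ∑ a ∈ I, (p a : ℝ) * ∏ b ∈ I with b < a, (1 - (p b : ℝ)) = 1 - ∏ a ∈ I, (1 - (p a : ℝ)) := by
  rw [prod_one_sub_ordered]; ring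

omit [Fintype ι] in
/-- For `I ⊆ A`: `Σ_{a∈I} p_a Π_{b∈A, b<a}(1 − p_b) ≤ 1 − Π_{a∈I}(1 − p_a)` (the first open coordinate of `A` lies in `I` only if some
coordinate of `I` is open). [this work] -/
theorem sum_firstOpen_le {I A : Finset ι} (hI : I ⊆ A) (p : ι → unitInterval) :
    ∑ a ∈ I, (p a : ℝ) * ∏ b ∈ A with b < a, (1 - (p b : ℝ)) ≤ 1 - ∏ a ∈ I, (1 - (p a : ℝ)) := by
  rw [← sum_firstOpen_eq I p]
  refine sum_le_sum fun a _ => mul_le_mul_of_nonneg_left ?_ (p_nonneg p a)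
  exact prod_le_prod_of_subset_of_le_one (filter_subset_filter _ hI) (fun b _ => sub_nonneg.2 (p_le_one p b))
    fun b _ _ => sub_le_self _ (p_nonneg p b)

omit [Fintype ι] in
/-- `Σ_{a∈A} sig_a = dlt·(1 − dlt)`. [this work] -/
theorem sum_sig (A : Finset ι) (p : ι → unitInterval) : ∑ a ∈ A, sig A p a = dlt A p * (1 - dlt A p) := by
  simp only [sig, ← mul_sum, sum_firstOpen_eq]; rfl

omit [Fintype ι] in
/-- `Σ_{a∈I} sig_a ≤ dlt·(1 − Π_{a∈I}(1−p_a))` for `I ⊆ A`. [this work] -/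
theorem sum_sig_le {I A : Finset ι} (hI : I ⊆ A) (p : ι → unitInterval) :
    ∑ a ∈ I, sig A p a ≤ dlt A p * (1 - ∏ a ∈ I, (1 - (p a : ℝ))) := by
  simp only [sig, ← mul_sum]
  exact mul_le_mul_of_nonneg_left (sum_firstOpen_le hI p) (dlt_nonneg A p)

/-! ### The singleton bookkeeping `sOne`, `sTwo` -/

/-- `sOne X = Σ_{a∈A} sig_a · 1_X({a})`: first-open mass of the singletons lying in `X`. [this work] -/
def sOne (A : Finset ι) (p : ι → unitInterval) (X : Set (Set ι)) : ℝ := ∑ a ∈ A, sig A p a * ind X {a}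

/-- `sTwo X Z = Σ_{a∈A} sig_a · 1_X({a}) · 1_Z({a})`: first-open mass of the singletons lying in both `X` and `Z`. [this work] -/
def sTwo (A : Finset ι) (p : ι → unitInterval) (X Z : Set (Set ι)) : ℝ := ∑ a ∈ A, sig A p a * (ind X {a} * ind Z {a})

omit [Fintype ι] in
/-- `sTwo` as a sum over the common singletons. [this work] -/
theorem sTwo_eq_sum_filter (A : Finset ι) (p : ι → unitInterval) (X Z : Set (Set ι)) :
    sTwo A p X Z = ∑ a ∈ A with ({a} : Set ι) ∈ X ∧ ({a} : Set ι) ∈ Z, sig A p a := by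
  rw [sTwo, sum_filter]
  refine sum_congr rfl fun a _ => ?_
  by_cases hX : ({a} : Set ι) ∈ X <;> by_cases hZ : ({a} : Set ι) ∈ Z <;>
    simp [ind_of_mem, ind_of_not_mem, hX, hZ]

omit [Fintype ι] in
/-- `sOne` as a sum over the singletons in `X`. [this work] -/
theorem sOne_eq_sum_filter (A : Finset ι) (p : ι → unitInterval) (X : Set (Set ι)) :
    sOne A p X = ∑ a ∈ A with ({a} : Set ι) ∈ X, sig A p a := by
  rw [sOne, sum_filter]
  refine sum_congr rfl fun a _ => ?_
  by_cases hX : ({a} : Set ι) ∈ X <;> simp [ind_of_mem, ind_of_not_mem, hX]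

omit [Fintype ι] in
/-- `0 ≤ sTwo`. [this work] -/
theorem sTwo_nonneg (A : Finset ι) (p : ι → unitInterval) (X Z : Set (Set ι)) : 0 ≤ sTwo A p X Z :=
  sum_nonneg fun a _ => mul_nonneg (sig_nonneg A p a) (mul_nonneg (ind_nonneg _ _) (ind_nonneg _ _))

omit [Fintype ι] in
/-- `sTwo X Z ≤ sOne X`. [this work] -/
theorem sTwo_le_sOne_left (A : Finset ι) (p : ι → unitInterval) (X Z : Set (Set ι)) : sTwo A p X Z ≤ sOne A p X :=
  sum_le_sum fun a _ => mul_le_mul_of_nonneg_left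
    (by nlinarith [ind_nonneg X ({a} : Set ι), ind_le_one Z ({a} : Set ι), ind_nonneg Z ({a} : Set ι)]) (sig_nonneg A p a)

omit [Fintype ι] in
/-- `sTwo X Z ≤ sOne Z`. [this work] -/
theorem sTwo_le_sOne_right (A : Finset ι) (p : ι → unitInterval) (X Z : Set (Set ι)) : sTwo A p X Z ≤ sOne A p Z :=
  sum_le_sum fun a _ => mul_le_mul_of_nonneg_left
    (by nlinarith [ind_nonneg Z ({a} : Set ι), ind_le_one X ({a} : Set ι), ind_nonneg X ({a} : Set ι)]) (sig_nonneg A p a)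

omit [Fintype ι] in
/-- `sTwo` is symmetric. [this work] -/
theorem sTwo_comm (A : Finset ι) (p : ι → unitInterval) (X Z : Set (Set ι)) : sTwo A p X Z = sTwo A p Z X := by
  simp only [sTwo, mul_comm (ind X _)]

omit [Fintype ι] in
/-- `sTwo X X = sOne X`. [this work] -/
theorem sTwo_self (A : Finset ι) (p : ι → unitInterval) (X : Set (Set ι)) : sTwo A p X X = sOne A p X := by
  refine sum_congr rfl fun a _ => ?_
  by_cases hX : ({a} : Set ι) ∈ X <;> simp [ind_of_mem, ind_of_not_mem, hX]

omit [Fintype ι] in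
/-- `sOne univ = dlt·(1 − dlt)`. [this work] -/
theorem sOne_univ (A : Finset ι) (p : ι → unitInterval) : sOne A p Set.univ = dlt A p * (1 - dlt A p) := by
  rw [← sum_sig A p]
  refine sum_congr rfl fun a _ => ?_
  rw [ind_of_mem (Set.mem_univ _), mul_one]

omit [Fintype ι] in
/-- `sTwo univ Z = sOne Z`. [this work] -/
theorem sTwo_univ_left (A : Finset ι) (p : ι → unitInterval) (Z : Set (Set ι)) : sTwo A p Set.univ Z = sOne A p Z := by
  refine sum_congr rfl fun a _ => ?_
  rw [ind_of_mem (Set.mem_univ _), one_mul]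

/-- **`sOne X ≤ dlt · μ(X)`** for an increasing `X`: the singletons `S` in `X` give `μ(X) ≥ μ(hit S) = 1 − Π_S(1−p)` and the first-open
bound gives `sOne X ≤ dlt·(1 − Π_S(1−p))`. [this work] -/
theorem sOne_le (A : Finset ι) (p : ι → unitInterval) {X : Set (Set ι)} (hU : IsUpperSet X) : sOne A p X ≤ dlt A p * pr p X := by
  set S : Finset ι := A.filter fun a => ({a} : Set ι) ∈ X with hS
  have hSA : S ⊆ A := filter_subset _ _
  have h1 : sOne A p X ≤ dlt A p * (1 - ∏ a ∈ S, (1 - (p a : ℝ))) := by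
    rw [sOne_eq_sum_filter]; exact sum_sig_le hSA p
  have h2 : 1 - ∏ a ∈ S, (1 - (p a : ℝ)) ≤ pr p X := by
    have hsub : hit S ⊆ X := by
      rintro ω ⟨a, ha, haω⟩
      have haX : ({a} : Set ι) ∈ X := (mem_filter.1 ha).2
      exact hU (Set.singleton_subset_iff.2 haω) haX
    have := pr_mono p hsub
    rw [pr_hit] at this
    exact this
  exact h1.trans (mul_le_mul_of_nonneg_left h2 (dlt_nonneg A p))

/-- **`sTwo X Z ≤ (1 + dlt)·Cov(X,Z)`** for increasing `A`-determined `X, Z` not containing `∅`. [this work] -/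
theorem sTwo_le_cov (A : Finset ι) (p : ι → unitInterval) {X Z : Set (Set ι)}
    (hXd : DeterminedBy X (↑A : Set ι)) (hZd : DeterminedBy Z (↑A : Set ι)) (hXu : IsUpperSet X) (hZu : IsUpperSet Z)
    (hX0 : (∅ : Set ι) ∉ X) (hZ0 : (∅ : Set ι) ∉ Z) :
    sTwo A p X Z ≤ (1 + dlt A p) * (pr p (X ∩ Z) - pr p X * pr p Z) := by
  have h1 : sTwo A p X Z ≤ dlt A p * (1 - ∏ a ∈ A with ({a} : Set ι) ∈ X ∧ ({a} : Set ι) ∈ Z, (1 - (p a : ℝ))) := by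
    rw [sTwo_eq_sum_filter]; exact sum_sig_le (filter_subset _ _) p
  have h2 := cov_ge_of_empty_notMem A p hXd hZd hXu hZu hX0 hZ0
  have hcov0 : 0 ≤ pr p (X ∩ Z) - pr p X * pr p Z :=
    le_trans (mul_nonneg (dlt_nonneg A p) (sub_nonneg.2 (prod_le_one (fun a _ => sub_nonneg.2 (p_le_one p a))
      fun a _ => sub_le_self _ (p_nonneg p a)))) h2
  nlinarith [dlt_nonneg A p]


/-! ### The certificate weight `Wt` on local configurations -/

/-- `rho a = (1 − p_a) Π_{b∈A, b<a}(1 − p_b)` — the amount by which the first-open attribution lowers the weight of the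
configuration "exactly `a` open". [this work] -/
def rho (A : Finset ι) (p : ι → unitInterval) (a : ι) : ℝ := (1 - (p a : ℝ)) * ∏ b ∈ A with b < a, (1 - (p b : ℝ))

omit [Fintype ι] in
/-- `0 ≤ rho ≤ 1`. [this work] -/
theorem rho_nonneg (A : Finset ι) (p : ι → unitInterval) (a : ι) : 0 ≤ rho A p a :=
  mul_nonneg (sub_nonneg.2 (p_le_one p a)) (prod_nonneg fun b _ => sub_nonneg.2 (p_le_one p b))

omit [Fintype ι] in
/-- `rho ≤ 1`. [this work] -/
theorem rho_le_one (A : Finset ι) (p : ι → unitInterval) (a : ι) : rho A p a ≤ 1 :=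
  mul_le_one₀ (sub_le_self _ (p_nonneg p a)) (prod_nonneg fun b _ => sub_nonneg.2 (p_le_one p b))
    (prod_le_one (fun b _ => sub_nonneg.2 (p_le_one p b)) fun b _ => sub_le_self _ (p_nonneg p b))

omit [Fintype ι] in
/-- `rho_a · μ{exactly a open} = sig_a`. [this work] -/
theorem rho_mul_pr_exactly (A : Finset ι) (p : ι → unitInterval) {a : ι} (ha : a ∈ A) :
    rho A p a * ((p a : ℝ) * ∏ b ∈ A.erase a, (1 - (p b : ℝ))) = sig A p a := by
  simp only [rho, sig, dlt]
  rw [← mul_prod_erase A (fun b => 1 - (p b : ℝ)) ha]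
  ring

/-- THE CERTIFICATE WEIGHT on configurations (read on the `A`-part only): `0` if `A` is closed, `(1 + dlt) − rho_a` if exactly the
coordinate `a` of `A` is open, `1 + dlt` if at least two coordinates of `A` are open. [this work] -/
def Wt (A : Finset ι) (p : ι → unitInterval) (ζ : Set ι) : ℝ :=
  (1 + dlt A p) * (1 - ind (noneOpen A) ζ) - ∑ a ∈ A, rho A p a * ind (exactly A a) ζ

omit [Fintype ι] in
/-- At most one of the events "exactly `a` open" holds. [folklore] -/
theorem sum_ind_exactly_le_one (A : Finset ι) (ζ : Set ι) : ∑ a ∈ A, ind (exactly A a) ζ ≤ 1 := by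
  by_cases h : ∃ a₀ ∈ A, ζ ∩ ↑A = {a₀}
  · obtain ⟨a₀, ha₀, h0⟩ := h
    have : ∀ a ∈ A, ind (exactly A a) ζ = if a = a₀ then 1 else 0 := by
      intro a _
      by_cases haa : a = a₀
      · rw [if_pos haa, ind_of_mem (show ζ ∈ exactly A a by rw [mem_exactly, h0, haa])]
      · rw [if_neg haa, ind_of_not_mem]
        intro hm
        rw [mem_exactly, h0, Set.singleton_eq_singleton_iff] at hm
        exact haa hm.symm
    rw [sum_congr rfl this, sum_ite_eq' A a₀ (fun _ => (1 : ℝ)), if_pos ha₀]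
  · have : ∀ a ∈ A, ind (exactly A a) ζ = 0 := fun a ha => ind_of_not_mem fun hm => h ⟨a, ha, hm⟩
    rw [sum_congr rfl this, sum_const_zero]; exact zero_le_one

omit [Fintype ι] in
/-- **`Wt ≥ 0`.** [this work] -/
theorem Wt_nonneg (A : Finset ι) (p : ι → unitInterval) (ζ : Set ι) : 0 ≤ Wt A p ζ := by
  rw [Wt]
  have hsum : ∑ a ∈ A, rho A p a * ind (exactly A a) ζ ≤ 1 :=
    le_trans (sum_le_sum fun a _ => mul_le_of_le_one_left (ind_nonneg _ _) (rho_le_one A p a)) (sum_ind_exactly_le_one A ζ)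
  by_cases h : ζ ∈ noneOpen A
  · have h0 : ∀ a ∈ A, rho A p a * ind (exactly A a) ζ = 0 := by
      intro a ha
      rw [ind_of_not_mem, mul_zero]
      rw [mem_exactly, mem_noneOpen.1 h]
      exact fun he => (Set.singleton_nonempty a).ne_empty he.symm
    rw [ind_of_mem h, sum_congr rfl h0, sum_const_zero]; simp
  · rw [ind_of_not_mem h]
    nlinarith [dlt_nonneg A p]

/-- **Expectation of `Wt` against two `A`-determined events**:
`E[Wt·1_X·1_Z] = (1 + dlt)·(μ(X ∩ Z) − dlt·1_X(∅)1_Z(∅)) − sTwo X Z`. [this work] -/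
theorem ex_Wt_mul (A : Finset ι) (p : ι → unitInterval) {X Z : Set (Set ι)} (hX : DeterminedBy X (↑A : Set ι))
    (hZ : DeterminedBy Z (↑A : Set ι)) :
    ∑ ζ, bernoulliWeight p ζ * (Wt A p ζ * (ind X ζ * ind Z ζ)) =
      (1 + dlt A p) * (pr p (X ∩ Z) - dlt A p * (ind X ∅ * ind Z ∅)) - sTwo A p X Z := by
  -- (i) the plain term
  have h1 : ∑ ζ, bernoulliWeight p ζ * (ind X ζ * ind Z ζ) = pr p (X ∩ Z) := by
    rw [pr_eq_sum]; exact sum_congr rfl fun ζ _ => by rw [ind_inter]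
  -- (ii) the all-closed term
  have h2 : ∑ ζ, bernoulliWeight p ζ * (ind (noneOpen A) ζ * (ind X ζ * ind Z ζ)) = dlt A p * (ind X ∅ * ind Z ∅) := by
    have hpt : ∀ ζ, ind (noneOpen A) ζ * (ind X ζ * ind Z ζ) = ind (noneOpen A) ζ * (ind X ∅ * ind Z ∅) := by
      intro ζ
      by_cases h : ζ ∈ noneOpen A
      · have he : ζ ∩ ↑A = ∅ ∩ ↑A := by rw [mem_noneOpen.1 h, Set.empty_inter]
        have hx : ind X ζ = ind X ∅ := by
          by_cases hm : ζ ∈ X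
          · rw [ind_of_mem hm, ind_of_mem ((mem_iff_of_inter_eq hX he).1 hm)]
          · rw [ind_of_not_mem hm, ind_of_not_mem (fun h' => hm ((mem_iff_of_inter_eq hX he).2 h'))]
        have hz : ind Z ζ = ind Z ∅ := by
          by_cases hm : ζ ∈ Z
          · rw [ind_of_mem hm, ind_of_mem ((mem_iff_of_inter_eq hZ he).1 hm)]
          · rw [ind_of_not_mem hm, ind_of_not_mem (fun h' => hm ((mem_iff_of_inter_eq hZ he).2 h'))]
        rw [hx, hz]
      · rw [ind_of_not_mem h, zero_mul, zero_mul]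
    calc ∑ ζ, bernoulliWeight p ζ * (ind (noneOpen A) ζ * (ind X ζ * ind Z ζ))
        = ∑ ζ, bernoulliWeight p ζ * ind (noneOpen A) ζ * (ind X ∅ * ind Z ∅) :=
          sum_congr rfl fun ζ _ => by rw [hpt ζ, mul_assoc]
      _ = dlt A p * (ind X ∅ * ind Z ∅) := by rw [← sum_mul, ← pr_eq_sum, pr_noneOpen]
  -- (iii) the exactly-one terms
  have h3 : ∀ a ∈ A, ∑ ζ, bernoulliWeight p ζ * (ind (exactly A a) ζ * (ind X ζ * ind Z ζ)) =
      (p a : ℝ) * (∏ b ∈ A.erase a, (1 - (p b : ℝ))) * (ind X {a} * ind Z {a}) := by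
    intro a ha
    have hpt : ∀ ζ, ind (exactly A a) ζ * (ind X ζ * ind Z ζ) = ind (exactly A a) ζ * (ind X {a} * ind Z {a}) := by
      intro ζ
      by_cases h : ζ ∈ exactly A a
      · have he : ζ ∩ ↑A = {a} ∩ ↑A := by
          rw [mem_exactly.1 h, Set.inter_eq_left.2 (Set.singleton_subset_iff.2 (mem_coe.2 ha))]
        have hx : ind X ζ = ind X {a} := by
          by_cases hm : ζ ∈ X
          · rw [ind_of_mem hm, ind_of_mem ((mem_iff_of_inter_eq hX he).1 hm)]
          · rw [ind_of_not_mem hm, ind_of_not_mem (fun h' => hm ((mem_iff_of_inter_eq hX he).2 h'))]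
        have hz : ind Z ζ = ind Z {a} := by
          by_cases hm : ζ ∈ Z
          · rw [ind_of_mem hm, ind_of_mem ((mem_iff_of_inter_eq hZ he).1 hm)]
          · rw [ind_of_not_mem hm, ind_of_not_mem (fun h' => hm ((mem_iff_of_inter_eq hZ he).2 h'))]
        rw [hx, hz]
      · rw [ind_of_not_mem h, zero_mul, zero_mul]
    calc ∑ ζ, bernoulliWeight p ζ * (ind (exactly A a) ζ * (ind X ζ * ind Z ζ))
        = ∑ ζ, bernoulliWeight p ζ * ind (exactly A a) ζ * (ind X {a} * ind Z {a}) :=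
          sum_congr rfl fun ζ _ => by rw [hpt ζ, mul_assoc]
      _ = (p a : ℝ) * (∏ b ∈ A.erase a, (1 - (p b : ℝ))) * (ind X {a} * ind Z {a}) := by
          rw [← sum_mul, ← pr_eq_sum, pr_exactly p ha]; congr; exact Subsingleton.elim _ _
  -- assemble
  have hexp : ∀ ζ, bernoulliWeight p ζ * (Wt A p ζ * (ind X ζ * ind Z ζ)) =
      (1 + dlt A p) * (bernoulliWeight p ζ * (ind X ζ * ind Z ζ))
      - (1 + dlt A p) * (bernoulliWeight p ζ * (ind (noneOpen A) ζ * (ind X ζ * ind Z ζ)))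
      - ∑ a ∈ A, rho A p a * (bernoulliWeight p ζ * (ind (exactly A a) ζ * (ind X ζ * ind Z ζ))) := by
    intro ζ
    have hs : ∑ a ∈ A, rho A p a * (bernoulliWeight p ζ * (ind (exactly A a) ζ * (ind X ζ * ind Z ζ))) =
        (bernoulliWeight p ζ * (ind X ζ * ind Z ζ)) * ∑ a ∈ A, rho A p a * ind (exactly A a) ζ := by
      rw [mul_sum]; exact sum_congr rfl fun a _ => by ring
    rw [hs, Wt]; ring
  rw [sum_congr rfl fun ζ _ => hexp ζ, sum_sub_distrib, sum_sub_distrib, ← mul_sum, ← mul_sum, h1, h2, sum_comm]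
  have h4 : ∑ a ∈ A, ∑ ζ, rho A p a * (bernoulliWeight p ζ * (ind (exactly A a) ζ * (ind X ζ * ind Z ζ))) = sTwo A p X Z := by
    rw [sTwo]
    refine sum_congr rfl fun a ha => ?_
    rw [← mul_sum, h3 a ha, ← rho_mul_pr_exactly A p ha]; ring
  rw [h4]; ring

end Ordered

/-! ### Localised events and the two-copy (block Fubini) representation -/

/-- The LOCALISATION of `X` at the outside configuration `ω`: `ζ ↦ [ (ζ ∩ A) ∪ (ω ∖ A) ∈ X ]` — the section of `X` over `ω ∖ A`, read as an
`A`-determined event of the whole cube. [this work] -/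
def loc (A : Finset ι) (ω : Set ι) (X : Set (Set ι)) : Set (Set ι) := {ζ | Set.ite (↑A : Set ι) ζ ω ∈ X}

omit [Fintype ι] in
/-- Membership in a localisation. [this work] -/
theorem mem_loc {A : Finset ι} {ω : Set ι} {X : Set (Set ι)} {ζ : Set ι} : ζ ∈ loc A ω X ↔ Set.ite (↑A : Set ι) ζ ω ∈ X := Iff.rfl

omit [Fintype ι] in
/-- The indicator of a localisation. [this work] -/
theorem ind_loc (A : Finset ι) (ω : Set ι) (X : Set (Set ι)) (ζ : Set ι) : ind (loc A ω X) ζ = ind X (Set.ite (↑A : Set ι) ζ ω) := by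
  by_cases h : Set.ite (↑A : Set ι) ζ ω ∈ X
  · rw [ind_of_mem h, ind_of_mem (mem_loc.2 h)]
  · rw [ind_of_not_mem h, ind_of_not_mem (fun h' => h (mem_loc.1 h'))]

omit [Fintype ι] in
/-- Localisations of increasing events are increasing. [this work] -/
theorem isUpperSet_loc (A : Finset ι) (ω : Set ι) {X : Set (Set ι)} (hX : IsUpperSet X) : IsUpperSet (loc A ω X) :=
  fun _ _ hle h => hX (Set.ite_mono _ hle le_rfl) h

omit [Fintype ι] in
/-- Localisations are `A`-determined. [this work] -/
theorem determinedBy_loc (A : Finset ι) (ω : Set ι) (X : Set (Set ι)) : DeterminedBy (loc A ω X) (↑A : Set ι) :=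
  (determinedBy_iff _ _).2 fun ζ ζ' h => by
    rw [mem_loc, mem_loc, Set.ite, Set.ite, h]

omit [Fintype ι] in
/-- Localisation commutes with intersection. [this work] -/
theorem loc_inter (A : Finset ι) (ω : Set ι) (X Y : Set (Set ι)) : loc A ω (X ∩ Y) = loc A ω X ∩ loc A ω Y := rfl

omit [Fintype ι] in
/-- The hitting event is its own localisation. [this work] -/
theorem loc_hit (A : Finset ι) (ω : Set ι) : loc A ω (hit A) = hit A := by
  ext ζ
  simp only [mem_loc, hit, Set.mem_setOf_eq, Set.ite, Set.mem_union, Set.mem_inter_iff, Set.mem_sdiff, mem_coe]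
  constructor
  · rintro ⟨a, ha, (⟨haζ, -⟩ | ⟨-, hna⟩)⟩
    · exact ⟨a, ha, haζ⟩
    · exact (hna ha).elim
  · rintro ⟨a, ha, haζ⟩; exact ⟨a, ha, Or.inl ⟨haζ, ha⟩⟩

omit [Fintype ι] in
/-- The outside configurations, as monotone arguments: `ω ↦ 1_X((ζ ∩ A) ∪ (ω ∖ A))` is increasing for increasing `X`. [this work] -/
theorem monotone_ind_ite {A : Finset ι} {X : Set (Set ι)} (hX : IsUpperSet X) (ζ : Set ι) :
    Monotone fun ω : Set ι => ind X (Set.ite (↑A : Set ι) ζ ω) :=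
  fun _ _ hle => (monotone_ind_of_isUpperSet hX) (Set.ite_mono _ le_rfl hle)

/-- **Resampling (block Fubini)**: `μ(X) = Σ_ω w(ω)·μ(loc_ω X)` — the probability of `X` is the average over the outside configuration of
the probability of its localisation. [folklore] -/
theorem pr_eq_sum_loc (p : ι → unitInterval) (A : Finset ι) (X : Set (Set ι)) :
    pr p X = ∑ ω, bernoulliWeight p ω * pr p (loc A ω X) := by
  have hbf := blockFubini (fun e => (p e : ℝ)) (↑A : Set ι) (fun x y : Set ι => ind X (x ∪ y))
  rw [show (∑ ω, weight (fun e => (p e : ℝ)) ω) = 1 from sum_bernoulliWeight p, one_mul] at hbf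
  have hl : ∑ ω, weight (fun e => (p e : ℝ)) ω * ind X (ω ∩ ↑A ∪ ω \ ↑A) = pr p X := by
    rw [pr_eq_sum]; exact sum_congr rfl fun ω _ => by rw [Set.inter_union_sdiff]
  rw [hl] at hbf
  rw [hbf]
  change ∑ ω, bernoulliWeight p ω * ∑ ω', bernoulliWeight p ω' * ind X (Set.ite (↑A : Set ι) ω ω') = _
  simp_rw [mul_sum]
  rw [sum_comm]
  refine sum_congr rfl fun ω' _ => ?_
  rw [pr_eq_sum, mul_sum]
  exact sum_congr rfl fun ω _ => by rw [ind_loc]; ring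

/-! ### The two-copy kernel -/

/-- The two-copy kernel `g(U₁,V₁;U₂,V₂) = 2μ(H U₁V₁) − θμ(U₁V₁) − μU₁·μ(H V₂) − μV₁·μ(H U₂) + θ μU₁ μV₂`, `H = hit A`,
`θ = 1 − dlt`: the integrand whose double expectation over two independent outside-configurations is `E₃(1_H,1_U,1_V)`. [this work] -/
def gfun (A : Finset ι) (p : ι → unitInterval) (U₁ V₁ U₂ V₂ : Set (Set ι)) : ℝ :=
  2 * pr p (hit A ∩ (U₁ ∩ V₁)) - (1 - dlt A p) * pr p (U₁ ∩ V₁) - pr p U₁ * pr p (hit A ∩ V₂)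
    - pr p V₁ * pr p (hit A ∩ U₂) + (1 - dlt A p) * (pr p U₁ * pr p V₂)

/-- The two-copy kernel through localisations (intersections pushed inside). [this work] -/
theorem gfun_loc (p : ι → unitInterval) (A : Finset ι) (U V : Set (Set ι)) (ω ω' : Set ι) :
    gfun A p (loc A ω U) (loc A ω V) (loc A ω' U) (loc A ω' V) =
      2 * pr p (loc A ω (hit A ∩ (U ∩ V))) - (1 - dlt A p) * pr p (loc A ω (U ∩ V))
        - pr p (loc A ω U) * pr p (loc A ω' (hit A ∩ V)) - pr p (loc A ω V) * pr p (loc A ω' (hit A ∩ U))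
        + (1 - dlt A p) * (pr p (loc A ω U) * pr p (loc A ω' V)) := by
  simp only [gfun, loc_inter, loc_hit]

end SahiHittingSlot

end Summit.CriticalPhenomena.PercolationContinuityZ3.Theorems
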